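import Mathlib.Analysis.SpecialFunctions.Trigonometric.Bounds
import Literature.MathematicalPhysics.QuantumLattice.LiebWuFillingIdentity
import HarnessLib

/-!
# Continuity of the Lieb–Wu filling in the cutoff; every density `0 < n ≤ 1` is attained

Family `hubbard`. Lieb–Wu, PRL 20 (1968) 1445: (13)–(14) "are to be solved subject to (15)–(16)",
i.e. for a PRESCRIBED density `N/N_a`; statement (c): "`N/N_a` is monotonically increasing with `Q`,
reaching `1` at `Q = π`" = Lieb–Wu, Physica A 321 (2003) 1, §5, THEOREM 3. For the `B = ∞`
Neumann-series solution (`liebWuSigmaAt`, `liebWuRhoAt`, filling `liebWuFillingAtCutoff U Q = 2∫σ_Q`,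
`LiebWuFillingIdentity`) this file PROVES

* `integral_abs_liebWuSigmaAt_sub_le`, `abs_liebWuFillingAtCutoff_sub_le`: `Q ↦ σ_Q` is Lipschitz
  into `L¹(ℝ)` and `Q ↦ N/N_a` is Lipschitz on `(0, π]` (constant `2/π + 16/(πU)`) — not printed as
  such: it is the contraction estimate `‖Ŵ‖ ≤ ½` of the proof of Theorem 1 applied to the difference
  of the fixed-point equations (S) at two cutoffs, `σ_Q - σ_{Q'} = (ξ_Q - ξ_{Q'}) + (Ŵ_Q - Ŵ_{Q'})σ_Q
  + Ŵ_{Q'}(σ_Q - σ_{Q'})`, with `ξ_Q` and the kernel of `Ŵ_Q` monotone in the cutoff (proof of Lemma 4);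
* `abs_liebWuRhoAt_le`, `abs_liebWuRhoAt_sub_le`, `abs_liebWuEnergyAtCutoff_sub_le`: `|ρ_Q| ≤ 1/2π + 4/(πU)`,
  `|ρ_Q - ρ_{Q'}| ≤ (πc)⁻¹ ‖σ_Q - σ_{Q'}‖₁`, and the energy (17) `Q ↦ e(Q) = liebWuEnergyAtCutoff U Q` is
  Lipschitz on `(0, π]` with constant `(2/π)(1 + 8/U)²` (`continuousOn_liebWuEnergyAtCutoff`) — explicit
  constants, so that a certified enclosure of `(n(Q), e(Q))` on a grid of cutoffs controls both functions
  between grid points;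
* `exists_liebWuFillingAtCutoff_eq`: **every density `0 < n ≤ 1` is the filling of the `B = ∞`
  solution for some cutoff `0 < Q ≤ π`** (intermediate value theorem between `N/N_a ≤ 2Q/π` and
  `N/N_a = 1` at `Q = π`, Theorem 3), hence `exists_isLiebWuEnergyAt`: `IsLiebWuEnergyAt U n ·` is
  non-vacuous at every such density (in particular at the benchmark density `n = 7/8`).

Not treated: STRICT monotonicity of `Q ↦ N/N_a` (Lemma 4 / Theorem 3 for `Q > π/2` rest on Lemma 3),
hence not the uniqueness of the cutoff at a given density. No definition, no named fact.

## References

* E. H. Lieb, F. Y. Wu, Physica A 321 (2003) 1–27 = arXiv:cond-mat/0207529, §5, Theorems 1–3, eqs. (S),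
  (W), (series), proof of Lemma 4 (key `LiebWuPhysicaA2003`); PRL 20 (1968) 1445, eqs. (15)–(17),
  statements (a)–(c) (key `LiebWuPRL1968`).
-/

noncomputable section

open MeasureTheory Set Real Filter intervalIntegral
open Literature.Analysis.SpecialFunctions Literature.Analysis.FunctionSpaces

namespace Literature.MathematicalPhysics.QuantumLattice

section Continuity

variable {U Q Q' : ℝ}

/-! ### The source `ξ_Q` is monotone in the cutoff -/

/-- **`ξ_Q` increases with `Q`** (its integrand `r(Λ - sin k) > 0`). [cite: LiebWuPhysicaA2003, §5, proof of Lemma 4] -/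
theorem liebWuXi_mono (hU : 0 < U) (hQ'0 : 0 ≤ Q') (hle : Q' ≤ Q) (x : ℝ) :
    liebWuXi U Q' x ≤ liebWuXi U Q x := by
  have hc : 0 < U / 4 := by positivity
  unfold liebWuXi
  refine mul_le_mul_of_nonneg_left ?_ (by positivity)
  exact intervalIntegral.integral_mono_interval (neg_le_neg hle) (by linarith) hle
    (Eventually.of_forall fun k => (sechKernel_pos hc _).le)
    (((continuous_sechKernel hc).comp (continuous_const.sub Real.continuous_sin)).intervalIntegrable _ _)

/-- `∫ |ξ_Q - ξ_{Q'}| = |Q - Q'|/(2π)` (`∫ ξ_Q = Q/2π` and monotonicity). [cite: LiebWuPhysicaA2003, §5, eq. (S)] -/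
theorem integral_abs_liebWuXi_sub (hU : 0 < U) (hQ : 0 < Q) (hQ' : 0 < Q') :
    ∫ x, |liebWuXi U Q x - liebWuXi U Q' x| = |Q - Q'| / (2 * π) := by
  obtain ⟨hi, hI⟩ := integrable_liebWuXi_and_integral hU hQ
  obtain ⟨hi', hI'⟩ := integrable_liebWuXi_and_integral hU hQ'
  rcases le_total Q' Q with hle | hle
  · have h : ∀ x, |liebWuXi U Q x - liebWuXi U Q' x| = liebWuXi U Q x - liebWuXi U Q' x :=
      fun x => abs_of_nonneg (sub_nonneg.2 (liebWuXi_mono hU hQ'.le hle x))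
    simp_rw [h]
    rw [integral_sub hi hi', hI, hI', abs_of_nonneg (sub_nonneg.2 hle)]
    ring
  · have h : ∀ x, |liebWuXi U Q x - liebWuXi U Q' x| = liebWuXi U Q' x - liebWuXi U Q x :=
      fun x => by rw [abs_sub_comm]; exact abs_of_nonneg (sub_nonneg.2 (liebWuXi_mono hU hQ.le hle x))
    simp_rw [h]
    rw [integral_sub hi' hi, hI, hI', abs_of_nonpos (sub_nonpos.2 hle)]
    ring

/-! ### Lipschitz dependence on the cutoff -/

/-- **`Q ↦ σ_Q` is Lipschitz into `L¹(ℝ)`:** `∫ |σ_Q - σ_{Q'}| ≤ |Q - Q'|/π + (8Q/(π²U)) |sin Q - sin Q'|`.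
From `σ_Q - σ_{Q'} = (ξ_Q - ξ_{Q'}) + (Ŵ_Q - Ŵ_{Q'})σ_Q + Ŵ_{Q'}(σ_Q - σ_{Q'})`, `|Ŵ_{Q'}δ| ≤ Ŵ_{Q'}|δ|`
and `∫Ŵ|δ| ≤ ½∫|δ|` (the contraction bound of the proof of Theorem 1). [cite: LiebWuPhysicaA2003, §5, proof of Theorem 1] -/
theorem integral_abs_liebWuSigmaAt_sub_le (hU : 0 < U) (hQ : 0 < Q) (hQπ : Q ≤ π)
    (hQ' : 0 < Q') (hQ'π : Q' ≤ π) :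
    ∫ x, |liebWuSigmaAt U Q x - liebWuSigmaAt U Q' x| ≤
      |Q - Q'| / π + 8 * Q / (π ^ 2 * U) * |Real.sin Q - Real.sin Q'| := by
  have hπ : π ≠ 0 := Real.pi_pos.ne'
  have hU0 : U ≠ 0 := hU.ne'
  have hσi := integrable_liebWuSigmaAt hU hQ
  have hσ'i := integrable_liebWuSigmaAt hU hQ'
  have hσ0 : ∀ t, 0 ≤ liebWuSigmaAt U Q t := fun t => (liebWuSigmaAt_pos hU hQ t).le
  have hδi : Integrable fun x => liebWuSigmaAt U Q x - liebWuSigmaAt U Q' x := hσi.sub hσ'i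
  have hδai : Integrable fun x => |liebWuSigmaAt U Q x - liebWuSigmaAt U Q' x| := hδi.abs
  obtain ⟨hξi, -⟩ := integrable_liebWuXi_and_integral hU hQ
  obtain ⟨hξ'i, -⟩ := integrable_liebWuXi_and_integral hU hQ'
  obtain ⟨-, -, hWQσi, -⟩ := liebWuW_props (Q := Q) hU hσi hσ0
  obtain ⟨-, -, hWQ'σi, -⟩ := liebWuW_props (Q := Q') hU hσi hσ0
  obtain ⟨-, -, hWai, hWaint, -⟩ := liebWuW_props (Q := Q') hU hδai (fun t => abs_nonneg _)
  -- pointwise: `|δ| ≤ |ξ_Q - ξ_{Q'}| + |Ŵ_Qσ - Ŵ_{Q'}σ| + Ŵ_{Q'}|δ|`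
  have hpt : ∀ x, |liebWuSigmaAt U Q x - liebWuSigmaAt U Q' x| ≤
      |liebWuXi U Q x - liebWuXi U Q' x| +
        |liebWuW U Q (liebWuSigmaAt U Q) x - liebWuW U Q' (liebWuSigmaAt U Q) x| +
        liebWuW U Q' (fun t => |liebWuSigmaAt U Q t - liebWuSigmaAt U Q' t|) x := by
    intro x
    have h1 := liebWuSigmaAt_eq_xi_add_W hU hQ x
    have h2 := liebWuSigmaAt_eq_xi_add_W hU hQ' x
    have h3 := liebWuW_sub hU Q' hσi hσ'i x
    have h4 := abs_liebWuW_le hU Q' hδi x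
    have hid : liebWuSigmaAt U Q x - liebWuSigmaAt U Q' x =
        (liebWuXi U Q x - liebWuXi U Q' x) +
          (liebWuW U Q (liebWuSigmaAt U Q) x - liebWuW U Q' (liebWuSigmaAt U Q) x) +
          liebWuW U Q' (fun t => liebWuSigmaAt U Q t - liebWuSigmaAt U Q' t) x := by
      linear_combination h1 - h2 + h3
    rw [hid]
    exact (abs_add_le _ _).trans (add_le_add (abs_add_le _ _) h4)
  -- integrate
  have hAi : Integrable fun x => |liebWuXi U Q x - liebWuXi U Q' x| := (hξi.sub hξ'i).abs
  have hBi : Integrable fun x =>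
      |liebWuW U Q (liebWuSigmaAt U Q) x - liebWuW U Q' (liebWuSigmaAt U Q) x| := (hWQσi.sub hWQ'σi).abs
  have hABi : Integrable fun x => |liebWuXi U Q x - liebWuXi U Q' x| +
      |liebWuW U Q (liebWuSigmaAt U Q) x - liebWuW U Q' (liebWuSigmaAt U Q) x| := hAi.add hBi
  have hI : ∫ x, |liebWuSigmaAt U Q x - liebWuSigmaAt U Q' x| ≤
      ∫ x, (|liebWuXi U Q x - liebWuXi U Q' x| +
        |liebWuW U Q (liebWuSigmaAt U Q) x - liebWuW U Q' (liebWuSigmaAt U Q) x| +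
        liebWuW U Q' (fun t => |liebWuSigmaAt U Q t - liebWuSigmaAt U Q' t|) x) :=
    integral_mono hδai (hABi.add hWai) hpt
  rw [integral_add hABi hWai, integral_add hAi hBi, integral_abs_liebWuXi_sub hU hQ hQ'] at hI
  have hB := integral_abs_liebWuW_sub_cutoff_le hU hσi hσ0 hQ.le hQπ hQ'.le hQ'π
  have hS := (integral_liebWuSigmaAt_mem_Icc hU hQ).2
  have hB' : ∫ x, |liebWuW U Q (liebWuSigmaAt U Q) x - liebWuW U Q' (liebWuSigmaAt U Q) x| ≤
      1 / (π * (U / 4)) * (Q / π) * |Real.sin Q - Real.sin Q'| :=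
    hB.trans (mul_le_mul_of_nonneg_right (mul_le_mul_of_nonneg_left hS (by positivity)) (abs_nonneg _))
  have hconv : 8 * Q / (π ^ 2 * U) * |Real.sin Q - Real.sin Q'| =
      2 * (1 / (π * (U / 4)) * (Q / π) * |Real.sin Q - Real.sin Q'|) := by
    field_simp
    ring
  rw [hconv]
  have : |Q - Q'| / π = 2 * (|Q - Q'| / (2 * π)) := by ring
  linarith

/-- **`Q ↦ N/N_a` is Lipschitz on `(0, π]`:** `|n(Q) - n(Q')| ≤ (2/π)(1 + 8/U) |Q - Q'|`
(`n = 2∫σ`, `|sin Q - sin Q'| ≤ |Q - Q'|`, `Q ≤ π`). [cite: LiebWuPhysicaA2003, §5, Theorems 1–2] -/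
theorem abs_liebWuFillingAtCutoff_sub_le (hU : 0 < U) (hQ : 0 < Q) (hQπ : Q ≤ π)
    (hQ' : 0 < Q') (hQ'π : Q' ≤ π) :
    |liebWuFillingAtCutoff U Q - liebWuFillingAtCutoff U Q'| ≤ 2 / π * (1 + 8 / U) * |Q - Q'| := by
  have hU0 : U ≠ 0 := hU.ne'
  have hπ := Real.pi_pos
  have hσi := integrable_liebWuSigmaAt hU hQ
  have hσ'i := integrable_liebWuSigmaAt hU hQ'
  have h := integral_abs_liebWuSigmaAt_sub_le hU hQ hQπ hQ' hQ'π
  have hsin := Real.abs_sin_sub_sin_le Q Q'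
  rw [liebWuFillingAtCutoff_eq_two_mul_integral hU hQ hQπ,
    liebWuFillingAtCutoff_eq_two_mul_integral hU hQ' hQ'π, ← mul_sub, ← integral_sub hσi hσ'i, abs_mul,
    abs_of_pos (by norm_num : (0 : ℝ) < 2)]
  have hδ : |∫ x, (liebWuSigmaAt U Q x - liebWuSigmaAt U Q' x)| ≤
      ∫ x, |liebWuSigmaAt U Q x - liebWuSigmaAt U Q' x| := abs_integral_le_integral_abs
  -- `8Q/(π²U) |Δ sin| ≤ 8/(πU) |ΔQ|`
  have hQ1 : Q / π ^ 2 ≤ 1 / π := by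
    rw [div_le_div_iff₀ (by positivity) hπ, one_mul, pow_two]
    exact mul_le_mul_of_nonneg_right hQπ hπ.le
  have h2 : 8 * Q / (π ^ 2 * U) * |Real.sin Q - Real.sin Q'| ≤ 8 / (π * U) * |Q - Q'| := by
    have e1 : 8 * Q / (π ^ 2 * U) = 8 / U * (Q / π ^ 2) := by field_simp
    have e2 : 8 / (π * U) = 8 / U * (1 / π) := by field_simp
    rw [e1, e2]
    exact mul_le_mul (mul_le_mul_of_nonneg_left hQ1 (by positivity)) hsin (abs_nonneg _) (by positivity)
  have e3 : 2 / π * (1 + 8 / U) * |Q - Q'| = 2 * (|Q - Q'| / π + 8 / (π * U) * |Q - Q'|) := by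
    field_simp
  rw [e3]
  linarith

/-- **The filling `Q ↦ N/N_a` is continuous on `(0, π]`.** [cite: LiebWuPhysicaA2003, §5, Theorems 1–3] -/
theorem continuousOn_liebWuFillingAtCutoff (hU : 0 < U) :
    ContinuousOn (liebWuFillingAtCutoff U) (Ioc 0 π) := by
  have hL : 0 < 2 / π * (1 + 8 / U) := by positivity
  refine Metric.continuousOn_iff.2 fun b hb ε hε => ⟨ε / (2 / π * (1 + 8 / U)), div_pos hε hL,
    fun a ha hab => ?_⟩
  rw [Real.dist_eq] at hab ⊢
  calc |liebWuFillingAtCutoff U a - liebWuFillingAtCutoff U b| ≤ 2 / π * (1 + 8 / U) * |a - b| :=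
        abs_liebWuFillingAtCutoff_sub_le hU ha.1 ha.2 hb.1 hb.2
    _ < 2 / π * (1 + 8 / U) * (ε / (2 / π * (1 + 8 / U))) := mul_lt_mul_of_pos_left hab hL
    _ = ε := by field_simp

/-! ### Lipschitz dependence of `ρ_Q` and of the energy (17) on the cutoff -/

/-- `|(h ∗ K_c)(y)| ≤ (πc)⁻¹ ∫|h|` (`0 < K_c ≤ (πc)⁻¹`). [folklore] -/
private theorem abs_integral_mul_cauchyDensity_le {h : ℝ → ℝ} {c : ℝ} (hc : 0 < c)
    (hhi : Integrable h) (y : ℝ) :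
    |∫ t, h t * cauchyDensity c (y - t)| ≤ 1 / (π * c) * ∫ t, |h t| := by
  calc |∫ t, h t * cauchyDensity c (y - t)| ≤ ∫ t, |h t * cauchyDensity c (y - t)| :=
        abs_integral_le_integral_abs
    _ ≤ ∫ t, 1 / (π * c) * |h t| := by
        refine integral_mono_of_nonneg (Eventually.of_forall fun t => abs_nonneg _) (hhi.abs.const_mul _)
          (Eventually.of_forall fun t => ?_)
        dsimp only
        rw [abs_mul, abs_of_pos (cauchyDensity_pos hc _), mul_comm (|h t|)]
        exact mul_le_mul_of_nonneg_right (cauchyDensity_le hc _) (abs_nonneg _)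
    _ = 1 / (π * c) * ∫ t, |h t| := MeasureTheory.integral_const_mul _ _

/-- **`|ρ_Q(k)| ≤ 1/2π + 4/(πU)`** on all of `ℝ` (`|cos k (σ_Q ∗ K)(sin k)| ≤ (πc)⁻¹ ∫σ_Q ≤ (πc)⁻¹ Q/π`).
[cite: LiebWuPhysicaA2003, §4, boxed equation for ρ] -/
theorem abs_liebWuRhoAt_le (hU : 0 < U) (hQ : 0 < Q) (hQπ : Q ≤ π) (k : ℝ) :
    |liebWuRhoAt U Q k| ≤ 1 / (2 * π) + 4 / (π * U) := by
  have hc : 0 < U / 4 := by positivity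
  have hπ := Real.pi_pos
  have hU0 : U ≠ 0 := hU.ne'
  have hS := (integral_liebWuSigmaAt_mem_Icc hU hQ).2
  have hG := abs_integral_mul_cauchyDensity_le hc (integrable_liebWuSigmaAt hU hQ) (Real.sin k)
  have habs : ∫ t, |liebWuSigmaAt U Q t| = ∫ t, liebWuSigmaAt U Q t :=
    MeasureTheory.integral_congr_ae (Eventually.of_forall fun t => abs_of_pos (liebWuSigmaAt_pos hU hQ t))
  rw [habs] at hG
  have hQ1 : Q / π ≤ 1 := (div_le_one hπ).2 hQπ
  unfold liebWuRhoAt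
  calc |1 / (2 * π) + Real.cos k * ∫ t, liebWuSigmaAt U Q t * cauchyDensity (U / 4) (Real.sin k - t)|
      ≤ |1 / (2 * π)| + |Real.cos k * ∫ t, liebWuSigmaAt U Q t * cauchyDensity (U / 4) (Real.sin k - t)| :=
        abs_add_le _ _
    _ ≤ 1 / (2 * π) + 1 * (1 / (π * (U / 4)) * (Q / π)) := by
        rw [abs_of_pos (by positivity : (0 : ℝ) < 1 / (2 * π)), abs_mul]
        exact add_le_add le_rfl (mul_le_mul (Real.abs_cos_le_one k)
          (hG.trans (mul_le_mul_of_nonneg_left hS (by positivity))) (abs_nonneg _) zero_le_one)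
    _ = 1 / (2 * π) + 4 / (π * U) * (Q / π) := by field_simp
    _ ≤ 1 / (2 * π) + 4 / (π * U) := by
        have h4 : 0 ≤ 4 / (π * U) := by positivity
        nlinarith

/-- **`|ρ_Q(k) - ρ_{Q'}(k)| ≤ (πc)⁻¹ ∫|σ_Q - σ_{Q'}|`** (`ρ_Q - ρ_{Q'} = cos k ((σ_Q - σ_{Q'}) ∗ K)(sin k)`).
[cite: LiebWuPhysicaA2003, §4, boxed equation for ρ] -/
theorem abs_liebWuRhoAt_sub_le (hU : 0 < U) (hQ : 0 < Q) (hQ' : 0 < Q') (k : ℝ) :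
    |liebWuRhoAt U Q k - liebWuRhoAt U Q' k| ≤
      1 / (π * (U / 4)) * ∫ t, |liebWuSigmaAt U Q t - liebWuSigmaAt U Q' t| := by
  have hc : 0 < U / 4 := by positivity
  have hσi := integrable_liebWuSigmaAt hU hQ
  have hσ'i := integrable_liebWuSigmaAt hU hQ'
  have hI : ∀ {h : ℝ → ℝ}, Integrable h →
      Integrable fun t => h t * cauchyDensity (U / 4) (Real.sin k - t) := fun hh =>
    hh.mul_bdd ((continuous_cauchyDensity hc).comp (continuous_const.sub continuous_id)).aestronglyMeasurable
      (Eventually.of_forall fun t => by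
        rw [Real.norm_eq_abs, abs_of_pos (cauchyDensity_pos hc _)]; exact cauchyDensity_le hc _)
  have hsub : liebWuRhoAt U Q k - liebWuRhoAt U Q' k = Real.cos k *
      ∫ t, (liebWuSigmaAt U Q t - liebWuSigmaAt U Q' t) * cauchyDensity (U / 4) (Real.sin k - t) := by
    have h : ∫ t, (liebWuSigmaAt U Q t - liebWuSigmaAt U Q' t) * cauchyDensity (U / 4) (Real.sin k - t) =
        (∫ t, liebWuSigmaAt U Q t * cauchyDensity (U / 4) (Real.sin k - t)) -
          ∫ t, liebWuSigmaAt U Q' t * cauchyDensity (U / 4) (Real.sin k - t) := by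
      simp_rw [sub_mul]
      exact integral_sub (hI hσi) (hI hσ'i)
    unfold liebWuRhoAt
    rw [h]
    ring
  rw [hsub, abs_mul]
  calc |Real.cos k| * |∫ t, (liebWuSigmaAt U Q t - liebWuSigmaAt U Q' t) *
        cauchyDensity (U / 4) (Real.sin k - t)|
      ≤ 1 * (1 / (π * (U / 4)) * ∫ t, |liebWuSigmaAt U Q t - liebWuSigmaAt U Q' t|) :=
        mul_le_mul (Real.abs_cos_le_one k) (abs_integral_mul_cauchyDensity_le hc (hσi.sub hσ'i) _)
          (abs_nonneg _) zero_le_one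
    _ = _ := one_mul _

/-- **`Q ↦ e(Q) = liebWuEnergyAtCutoff U Q` (eq. (17)) is Lipschitz on `(0, π]`** with constant
`(2/π)(1 + 8/U)²`: `e(Q) - e(Q') = -2[∫_{-Q}^{Q} (ρ_Q - ρ_{Q'}) cos k + (∫_{-Q}^{-Q'} - ∫_{Q}^{Q'}) ρ_{Q'} cos k]`
with `|ρ_Q - ρ_{Q'}| ≤ (πc)⁻¹ ∫|σ_Q - σ_{Q'}| ≤ (4/πU)(1/π)(1 + 8/U)|Q - Q'|` and `|ρ_{Q'}| ≤ 1/2π + 4/(πU)`.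
(Not printed as such; the contraction estimate of Theorem 1 made quantitative.) [cite: LiebWuPhysicaA2003, §5, Theorems 1–3] -/
theorem abs_liebWuEnergyAtCutoff_sub_le (hU : 0 < U) (hQ : 0 < Q) (hQπ : Q ≤ π)
    (hQ' : 0 < Q') (hQ'π : Q' ≤ π) :
    |liebWuEnergyAtCutoff U Q - liebWuEnergyAtCutoff U Q'| ≤ 2 / π * (1 + 8 / U) ^ 2 * |Q - Q'| := by
  have hπ := Real.pi_pos
  have hπ0 : π ≠ 0 := hπ.ne'
  have hU0 : U ≠ 0 := hU.ne'
  -- `‖σ_Q - σ_{Q'}‖₁ ≤ (1/π)(1 + 8/U)|Q - Q'|`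
  have hδ0 := integral_abs_liebWuSigmaAt_sub_le hU hQ hQπ hQ' hQ'π
  have hsin := Real.abs_sin_sub_sin_le Q Q'
  have hQ1 : Q / π ^ 2 ≤ 1 / π := by
    rw [div_le_div_iff₀ (by positivity) hπ, one_mul, pow_two]
    exact mul_le_mul_of_nonneg_right hQπ hπ.le
  have hδ : ∫ x, |liebWuSigmaAt U Q x - liebWuSigmaAt U Q' x| ≤ 1 / π * (1 + 8 / U) * |Q - Q'| := by
    have h2 : 8 * Q / (π ^ 2 * U) * |Real.sin Q - Real.sin Q'| ≤ 8 / (π * U) * |Q - Q'| := by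
      have e1 : 8 * Q / (π ^ 2 * U) = 8 / U * (Q / π ^ 2) := by field_simp
      have e2 : 8 / (π * U) = 8 / U * (1 / π) := by field_simp
      rw [e1, e2]
      exact mul_le_mul (mul_le_mul_of_nonneg_left hQ1 (by positivity)) hsin (abs_nonneg _) (by positivity)
    have e : 1 / π * (1 + 8 / U) * |Q - Q'| = |Q - Q'| / π + 8 / (π * U) * |Q - Q'| := by
      field_simp
    rw [e]
    linarith
  -- sup bounds for the integrands
  have hM1 : ∀ k ∈ Set.uIoc (-Q) Q, ‖(liebWuRhoAt U Q k - liebWuRhoAt U Q' k) * Real.cos k‖ ≤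
      1 / (π * (U / 4)) * (1 / π * (1 + 8 / U) * |Q - Q'|) := by
    intro k _
    rw [Real.norm_eq_abs, abs_mul]
    calc |liebWuRhoAt U Q k - liebWuRhoAt U Q' k| * |Real.cos k|
        ≤ (1 / (π * (U / 4)) * ∫ t, |liebWuSigmaAt U Q t - liebWuSigmaAt U Q' t|) * 1 :=
          mul_le_mul (abs_liebWuRhoAt_sub_le hU hQ hQ' k) (Real.abs_cos_le_one k) (abs_nonneg _)
            (by positivity)
      _ ≤ _ := by rw [mul_one]; exact mul_le_mul_of_nonneg_left hδ (by positivity)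
  have hM2 : ∀ k, ‖liebWuRhoAt U Q' k * Real.cos k‖ ≤ 1 / (2 * π) + 4 / (π * U) := fun k => by
    rw [Real.norm_eq_abs, abs_mul]
    calc |liebWuRhoAt U Q' k| * |Real.cos k| ≤ (1 / (2 * π) + 4 / (π * U)) * 1 :=
          mul_le_mul (abs_liebWuRhoAt_le hU hQ' hQ'π k) (Real.abs_cos_le_one k) (abs_nonneg _) (by positivity)
      _ = _ := mul_one _
  -- interval integrability and the decomposition of `e(Q) - e(Q')`
  have hfi : ∀ a b, IntervalIntegrable (fun k => liebWuRhoAt U Q k * Real.cos k) volume a b :=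
    fun a b => ((continuous_liebWuRhoAt hU hQ).mul Real.continuous_cos).intervalIntegrable _ _
  have hgi : ∀ a b, IntervalIntegrable (fun k => liebWuRhoAt U Q' k * Real.cos k) volume a b :=
    fun a b => ((continuous_liebWuRhoAt hU hQ').mul Real.continuous_cos).intervalIntegrable _ _
  have hsplit : (∫ k in -Q..Q, liebWuRhoAt U Q k * Real.cos k) -
      ∫ k in -Q'..Q', liebWuRhoAt U Q' k * Real.cos k =
      (∫ k in -Q..Q, (liebWuRhoAt U Q k - liebWuRhoAt U Q' k) * Real.cos k) +
        ((∫ k in -Q..-Q', liebWuRhoAt U Q' k * Real.cos k) -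
          ∫ k in Q..Q', liebWuRhoAt U Q' k * Real.cos k) := by
    rw [← intervalIntegral.integral_interval_sub_interval_comm (hgi _ _) (hgi _ _) (hgi _ _)]
    have h : ∫ k in -Q..Q, (liebWuRhoAt U Q k - liebWuRhoAt U Q' k) * Real.cos k =
        (∫ k in -Q..Q, liebWuRhoAt U Q k * Real.cos k) - ∫ k in -Q..Q, liebWuRhoAt U Q' k * Real.cos k := by
      simp_rw [sub_mul]
      exact intervalIntegral.integral_sub (hfi _ _) (hgi _ _)
    rw [h]
    ring
  unfold liebWuEnergyAtCutoff liebWuEnergyPerSite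
  rw [← mul_sub, hsplit, abs_mul, abs_neg, abs_two]
  have b1 := intervalIntegral.norm_integral_le_of_norm_le_const hM1
  have b2 := intervalIntegral.norm_integral_le_of_norm_le_const (a := -Q) (b := -Q') fun k _ => hM2 k
  have b3 := intervalIntegral.norm_integral_le_of_norm_le_const (a := Q) (b := Q') fun k _ => hM2 k
  rw [Real.norm_eq_abs] at b1 b2 b3
  rw [show |Q - -Q| = 2 * Q by rw [abs_of_nonneg (by linarith)]; ring] at b1
  rw [show -Q' - -Q = Q - Q' by ring] at b2
  rw [show |Q' - Q| = |Q - Q'| from abs_sub_comm _ _] at b3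
  have hQ2 : 0 ≤ 1 - Q / π := by rw [sub_nonneg, div_le_one hπ]; exact hQπ
  have hkey : 2 / π * (1 + 8 / U) ^ 2 * |Q - Q'| -
      2 * (1 / (π * (U / 4)) * (1 / π * (1 + 8 / U) * |Q - Q'|) * (2 * Q) +
        ((1 / (2 * π) + 4 / (π * U)) * |Q - Q'| + (1 / (2 * π) + 4 / (π * U)) * |Q - Q'|)) =
      16 / (π * U) * (1 + 8 / U) * |Q - Q'| * (1 - Q / π) := by
    field_simp
    ring
  have hpos : 0 ≤ 16 / (π * U) * (1 + 8 / U) * |Q - Q'| * (1 - Q / π) := mul_nonneg (by positivity) hQ2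
  calc 2 * |(∫ k in -Q..Q, (liebWuRhoAt U Q k - liebWuRhoAt U Q' k) * Real.cos k) +
        ((∫ k in -Q..-Q', liebWuRhoAt U Q' k * Real.cos k) - ∫ k in Q..Q', liebWuRhoAt U Q' k * Real.cos k)|
      ≤ 2 * (|∫ k in -Q..Q, (liebWuRhoAt U Q k - liebWuRhoAt U Q' k) * Real.cos k| +
          (|∫ k in -Q..-Q', liebWuRhoAt U Q' k * Real.cos k| +
            |∫ k in Q..Q', liebWuRhoAt U Q' k * Real.cos k|)) :=
        mul_le_mul_of_nonneg_left ((abs_add_le _ _).trans (add_le_add le_rfl (abs_sub _ _))) (by norm_num)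
    _ ≤ 2 * (1 / (π * (U / 4)) * (1 / π * (1 + 8 / U) * |Q - Q'|) * (2 * Q) +
          ((1 / (2 * π) + 4 / (π * U)) * |Q - Q'| + (1 / (2 * π) + 4 / (π * U)) * |Q - Q'|)) :=
        mul_le_mul_of_nonneg_left (add_le_add b1 (add_le_add b2 b3)) (by norm_num)
    _ ≤ 2 / π * (1 + 8 / U) ^ 2 * |Q - Q'| := by linarith

/-- **The energy `Q ↦ e(Q)` is continuous on `(0, π]`.** [cite: LiebWuPhysicaA2003, §5, Theorems 1–3] -/
theorem continuousOn_liebWuEnergyAtCutoff (hU : 0 < U) :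
    ContinuousOn (liebWuEnergyAtCutoff U) (Ioc 0 π) := by
  have hL : 0 < 2 / π * (1 + 8 / U) ^ 2 := by positivity
  refine Metric.continuousOn_iff.2 fun b hb ε hε => ⟨ε / (2 / π * (1 + 8 / U) ^ 2), div_pos hε hL,
    fun a ha hab => ?_⟩
  rw [Real.dist_eq] at hab ⊢
  calc |liebWuEnergyAtCutoff U a - liebWuEnergyAtCutoff U b| ≤ 2 / π * (1 + 8 / U) ^ 2 * |a - b| :=
        abs_liebWuEnergyAtCutoff_sub_le hU ha.1 ha.2 hb.1 hb.2
    _ < 2 / π * (1 + 8 / U) ^ 2 * (ε / (2 / π * (1 + 8 / U) ^ 2)) := mul_lt_mul_of_pos_left hab hL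
    _ = ε := by field_simp

/-! ### Every density `0 < n ≤ 1` is attained -/

/-- **Every density is attained at `B = ∞`:** for `U > 0` and `0 < n ≤ 1` there is a cutoff `0 < Q ≤ π`
whose solution has filling `N/N_a = n` (intermediate value theorem: `N/N_a ≤ 2Q/π` is `≤ n` at `Q = πn/2`,
and `N/N_a = 1` at `Q = π`, Theorem 3). [cite: LiebWuPhysicaA2003, §5, Theorem 3] -/
theorem exists_liebWuFillingAtCutoff_eq (hU : 0 < U) {n : ℝ} (hn : n ∈ Ioc (0 : ℝ) 1) :
    ∃ Q ∈ Ioc (0 : ℝ) π, liebWuFillingAtCutoff U Q = n := by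
  obtain ⟨hn0, hn1⟩ := hn
  have hπ := Real.pi_pos
  have hQ₀0 : 0 < π * n / 2 := by positivity
  have hQ₀π : π * n / 2 ≤ π := by nlinarith
  have hcont : ContinuousOn (liebWuFillingAtCutoff U) (Icc (π * n / 2) π) :=
    (continuousOn_liebWuFillingAtCutoff hU).mono fun Q hQ => ⟨hQ₀0.trans_le hQ.1, hQ.2⟩
  have hlo : liebWuFillingAtCutoff U (π * n / 2) ≤ n :=
    (liebWuFillingAtCutoff_mem_Icc hU hQ₀0 hQ₀π).2.trans (le_of_eq (by field_simp))
  have hhi : n ≤ liebWuFillingAtCutoff U π := by rw [liebWuFillingAtCutoff_pi hU]; exact hn1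
  obtain ⟨Q, hQ, hQn⟩ := intermediate_value_Icc hQ₀π hcont ⟨hlo, hhi⟩
  exact ⟨Q, ⟨hQ₀0.trans_le hQ.1, hQ.2⟩, hQn⟩

/-- **`IsLiebWuEnergyAt U n ·` is non-vacuous at every density `0 < n ≤ 1`** (`U > 0`): some cutoff
`Q ∈ (0, π]` has filling `n`, and its energy (17) is a Lieb–Wu energy at filling `n`. In particular the
benchmark density `n = 7/8` of the 2D target window has a 1D Lieb–Wu energy in the sense of the tree.
[cite: LiebWuPRL1968, eqs. (15), (17) and statements (a)–(c)] -/
theorem exists_isLiebWuEnergyAt (hU : 0 < U) {n : ℝ} (hn : n ∈ Ioc (0 : ℝ) 1) :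
    ∃ e, IsLiebWuEnergyAt U n e := by
  obtain ⟨Q, hQ, hQn⟩ := exists_liebWuFillingAtCutoff_eq hU hn
  exact ⟨liebWuEnergyAtCutoff U Q, (isLiebWuEnergyAt_iff_cutoff hU).2 ⟨Q, hQ.1, hQ.2, hQn, rfl⟩⟩

end Continuity

end Literature.MathematicalPhysics.QuantumLattice

end
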